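import Literature.AnabelianGeometry.EtaleTheta.TowerOfSetting
import Literature.AnabelianGeometry.EtaleTheta.StandardEnvOfSetting
import HarnessLib

/-!
# [EtTh] Cor 2.19 (iii), the standard-type RIGIDITY clause ("up to an `l`-th root of unity"), over the
# §1 model tower of `X̲̲` (companion of `ThetaSystems.lean` / `TowerOfSetting.lean`)

Mochizuki, *The Étale Theta Function …* [EtTh], Publ. RIMS 45 (2009), §2, Cor 2.19 (iii), PRIMS text
p.65 (bib key `MochizukiEtTh2009`; locators `p.N` = PDF pages): "(Constant Multiple Rigidity) Suppose
further that `η̲̈^{Θ,l·ℤ×μ₂}` is of standard type … an arbitrary automorphism of `Π•_X` preserves this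
collection of classes [up to … composition with an automorphism of `(l·Δ•_Θ) ⊗ ℤ/Nℤ` … induced by some
multiple of the collection of classes by an `l`-th root of unity]".

Seat abc-iut-L2-t2 (typer of §2). The abstract tower file `ThetaSystems.lean` types the hypothesis-free
FUNCTORIALITY content `ThetaEnvTower.Cor219_iii` (the pulled-back collections differ from the original
ones by a compatible continuous inflated `G_K`-cocycle family `c` — true for every associated orbit),
and deliberately NOT the rigidity clause, which is false for non-standard collections (audits
abc-iut-L6-t23 20:37:06Z / 20:43:10Z; review of p406836): the printed hypothesis "of standard type"
(Def 1.9 (ii), Def 2.7) is a condition on the VALUES of the classes at the torsion points `τ^{±1}`, i.e.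
on §1 data that an abstract `ThetaEnvTower` does not carry. This file types the rigidity clause where
that data lives — over abc-iut-L2-t8's INSTANTIATED tower `DoubleUnderline.thetaEnvTower`
(`TowerOfSetting.lean`) of the §1 model, under abc-iut-L2-t8's transfer
`MuTwoSetting.OrbitsOfStandardType` (Def 2.7, `StandardEnvOfSetting.lean`) of abc-iut-L2-t1's
`MuTwoSetting.IsOfStandardType` (Def 1.9 (ii), `ConstantMultipleRigidity.lean`) for an admissible `ε_Z`
(Def 1.7): `MuTwoSetting.Cor219_iii_std`. "An `l`-th root of unity" is typed, for the compatible family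
`c = (c_M)_{M ∈ E}` of classes in `lim_M H¹(G_K, μ_M) = (K^×)^∧`, as "`c_M^l` is a coboundary at every
level" (the `l`-torsion of `(K^×)^∧` is `μ_l(K)`; criterion of abc-iut-L6-t23's R-9 note 20:25:22Z).
Author's «Comments on [EtTh]» (Mar 2022): item (xxxii) — the second display of Cor 2.19 (iii) reads
`H¹(Π^tp_Ÿ, (l·Δ_Θ))` (the collections are `l·Δ_Θ`-valued, as in the tower's `thetaCocycles`); item (v) —
`l` odd, Cor 2.18/2.19 applied only for the curves `X` (the setting of `TowerOfSetting.lean`).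
Statements only (a named `Prop` fact; its proof is Cor 2.8 (i) / Thm 1.10, deep); nothing is asserted.
HONEST FRAMING: [EtTh] is a refereed paper typed statements-first; no side is taken on [IUTchIII]
Cor 3.12; typed ≠ discharged.
-/

noncomputable section

namespace Literature.AnabelianGeometry.EtaleTheta

open Literature.AnabelianGeometry.SemiGraphs

namespace MuTwoSetting

variable {p : ℕ} [Fact p.Prime] {M : MuTwoSetting p}

/-- **Corollary 2.19 (iii) (Constant Multiple Rigidity), WITH the standard-type rigidity clause**, over the
§1 model tower of `X̲̲` (`DoubleUnderline.thetaEnvTower`): if the orbits of the étale theta class are of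
standard type (Def 2.7 / Def 1.9 (ii), for the admissible `ε_Z` of Def 1.7 and standard data `S`), then
for every automorphism `γ` of `Π^tp_X̲̲` stabilising `Π^tp_Ÿ̲̲`, with the coefficient automorphisms `γ̄_M`
it induces on `(l·Δ_Θ) ⊗ ℤ/Mℤ ≅ μ_M` (Cor 2.18 (i)), the pulled-back collections of mod-`M` theta
cocycles are the original collections multiplied by a COMPATIBLE family `c = (c_M)_{M ∈ E}` of continuous
`G_K`-cocycles (the conclusion of `ThetaEnvTower.Cor219_iii`) **which is an `l`-th root of unity**:
`c_M^l` is a coboundary at every level `M ∈ E`. [cite: MochizukiEtTh2009, Cor 2.19(iii) p.65] -/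
def Cor219_iii_std {E : M.toThetaSetting.EtaleThetaData} {l : ℕ} (C : E.DoubleUnderline l)
    {Es : Set ℕ+} (τ : M.toThetaSetting.CyclotomeTower l Es) (hC : M.toThetaSetting.Compat)
    (hS : M.toThetaSetting.Sec2Hyps) (εZ : M.GtpC) (S : M.StandardData E.toKummerData) : Prop :=
  OrbitsOfStandardType C hC εZ S → M.IsAdmissibleEpsZ εZ →
    let T := C.thetaEnvTower τ hC hS
    ∀ (γ : T.PiX ≃ₜ* T.PiX) (hγ : T.PiYdd.map γ.toMulEquiv.toMonoidHom = T.PiYdd)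
      (γμ : ∀ N : Es, T.mu N ≃* T.mu N)
      (_ : ∀ (N : Es) (g : T.lDeltaTheta) (hg : γ g ∈ T.lDeltaTheta),
        T.thetaMod N ⟨γ g, hg⟩ = γμ N (T.thetaMod N g)),
      ∃ c : ∀ N : Es, T.G → T.mu N,
        (∀ N, CycEnvelope.IsEnvCocycle (MonoidHom.id T.G) (T.chi N) (c N)) ∧
        (∀ N, IsLocallyConstant (c N ∘ T.aug)) ∧
        (∀ (N N' : Es) (h : (N : ℕ+) ∣ N'), T.red N N' h ∘ c N' = c N) ∧
        (∀ N, T.pullbackCocycle N γ hγ (γμ N) '' T.thetaCocycles N =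
          (fun η => η * (c N ∘ T.aug ∘ T.PiYdd.subtype)) '' T.thetaCocycles N) ∧
        ∀ N : Es, ∃ d : T.mu N, ∀ g : T.G,
          c N g ^ l = CycEnvelope.coboundary (MonoidHom.id T.G) (T.chi N) d g

/-- Disclosure: under its antecedents, `Cor219_iii_std` REFINES the hypothesis-free functoriality fact
`ThetaEnvTower.Cor219_iii` of the model tower (drop the torsion clause).
[cite: MochizukiEtTh2009, Cor 2.19(iii) p.65] -/
theorem cor219_iii_of_std {E : M.toThetaSetting.EtaleThetaData} {l : ℕ} {C : E.DoubleUnderline l}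
    {Es : Set ℕ+} {τ : M.toThetaSetting.CyclotomeTower l Es} {hC : M.toThetaSetting.Compat}
    {hS : M.toThetaSetting.Sec2Hyps} {εZ : M.GtpC} {S : M.StandardData E.toKummerData}
    (h : Cor219_iii_std C τ hC hS εZ S) (hstd : OrbitsOfStandardType C hC εZ S)
    (hε : M.IsAdmissibleEpsZ εZ) : (C.thetaEnvTower τ hC hS).Cor219_iii := by
  intro γ hγ γμ hμ
  obtain ⟨c, h1, h2, h3, h4, -⟩ := h hstd hε γ hγ γμ hμ
  exact ⟨c, h1, h2, h3, h4⟩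

end MuTwoSetting

end Literature.AnabelianGeometry.EtaleTheta

end
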